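import Literature.MathematicalPhysics.PowerSystems.QuadraticDroopReducedJacobianStability
import HarnessLib

/-!
# Quadratic droop control is inverse-optimal (Simpson-Porco–Dörfler–Bullo 2017, Proposition 4.1):
# with `K_i = κ_i` the unique stable equilibrium `(E_L^Z, E_I^Z)` of the closed loop is the unique
# minimiser of `C = 𝒬_loss + 𝒬_load + C_volt`

Topic `Literature/MathematicalPhysics/PowerSystems` (LADDER-GRIDFUSION rung G3.b «droop microgrid
with Q–V dynamics», quadratic-droop lineage; seat gridfusion-lit-2, g15).  Fourth file on
[SimpsonporcoDorflerBullo2017] = IEEE TAC 62 (2017) 1239–1253 = arXiv:1507.00431 (held text read on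
the page this session: §4.1 p0013 L1–L60, proof p0013 L50 – p0014 L10).  Companions:
`QuadraticDroopVoltageStabilization.lean` (the model `QuadDroopNetwork`, the closed loop (3.3),
Theorem 3.1 `isEquilibrium_iff_reducedPowerFlow`, Theorem 3.3 / `ziVoltage` / `ziState`,
Proposition 7.2, Lemma 7.1), `QuadraticDroopReducedJacobianStability.lean` (Theorem 3.2's DAE tier,
`theorem_3_3_locallyExpStable`), `QuadraticDroopZIPLoads.lean` (Theorem 3.4).

THE PRINTED STATEMENT (§4.1, p0013).  Constant-impedance loads `Q_i(E_i) = b_shunt,i E_i²` (4.1).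
«the total reactive power `𝒬_loss` absorbed by the inductive transmission lines of the microgrid is
`𝒬_loss(E_L, E_I) = Σ_{{i,j} ∈ ℰ} B_ij(E_i − E_j)²` … the total reactive power consumed by the loads is
`𝒬_load(E_L) = −Σ_{i ∈ L} b_shunt,i E_i²` … `C_volt(E_I) = −Σ_{i ∈ I} κ_i(E_i − E_i*)²` (4.2), where
`κ_i < 0` … `minimize_{E ∈ ℝ^{n+m}_{>0}} C = 𝒬_loss(E) + 𝒬_load(E_L) + C_volt(E_I)` (4.3).»
«Proposition 4.1 (Optimality and Quadratic Droop). Consider the closed-loop microgrid system (3.3)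
with constant-impedance loads (4.1) and controller gains `{K_i}`, and the optimization problem (4.3)
with cost coefficients `{κ_i}`. Assume as in Theorem 3.3 that `−(B_red + [b_shunt])` is an `M`-matrix.
If the parameters are selected such that `K_i = κ_i` for each `i ∈ I`, then the unique locally
exponentially stable equilibrium `(E_L^Z, E_I^Z) ∈ ℝ^{n+m}_{>0}` of the closed-loop system (3.3) is equal
to the unique minimizer of the optimization problem (4.3), and both are given by
`E_L^Z = (B_red + [b_shunt])⁻¹B_redE_L* ∈ ℝ^n_{>0}` (4.4), with `E_I^Z` recovered by inserting (4.4) into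
(3.8).»  And before it: «Conversely, any quadratic droop controller solves an optimization problem of
the form (4.3) for appropriate coefficients `κ_i`» — here the cost is DEFINED with coefficients `κ`,
and every statement below is about `κ = K` (the file's `W.K`), which is both readings at once.

THE PRINTED PROOF (p0013 L50 – p0014 L10), followed step by step.  (1) «That `(E_L^Z, E_I^Z)` is the
unique locally exponentially stable equilibrium of (3.3) follows immediately from Theorem 3.3 by setting
`I_shunt = 0`» — §5 calls the companions' `theorem_3_3_originalNetwork` / `theorem_3_3_locallyExpStable`
BY NAME with `I_shunt = 0`.  (2) «In vector notation, `𝒬_loss = −EᵀBE`, `𝒬_load = −E_Lᵀ[b_shunt]E_L`,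
`C_volt = −(E_I − E_I*)ᵀK_I(E_I − E_I*)` … the total cost may be written as the quadratic form
`C = xᵀ𝓑x`» — §1 defines the three terms in this vector notation (`Qloss`, `Qload`, `Cvolt`,
`optCost`; `Qloss_eq_edgeSum` recovers the printed edge sum `Σ_{{i,j}} B_ij(E_i − E_j)²` for a
susceptance matrix built from branch data) and §2 proves the quadratic-form identity
`C(E) = Eᵀ𝒜E − 2Eᵀc − E_I*ᵀK_IE_I*` with `𝒜 = −(B + blkdiag([b_shunt], K_I))` (the coefficient matrix of
(4.5), negated) and `c = (0, −K_IE_I*)` (`optCost_eq_quadForm`).  (3) «The first order optimality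
conditions `∇C(E) = 0` yield (4.5)» — §2 `hasFDerivAt_optCost` (`∇C(E)h = 2hᵀ(𝒜E − c)`) and
`fderiv_optCost_eq_zero_iff` (`∇C(E) = 0 ⟺ 𝒜E = c ⟺ (4.5)`).  (4) «Solving the second block of
equations in (4.5) for `E_I` yields the quadratic droop inverter voltages (3.8). Substituting … yields
(4.6) … exactly the reduced power flow equation (3.12) with `I_shunt = 0`» — §3 `firstOrder_iff_eq_ziState`
(`𝒜E = c ⟺ E = (E_L^Z, W₂(E_L^Z, E_I*))`) and §4 `isEquilibrium_zLoads_iff_eq_ziState` (positive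
equilibria of (3.3) with Z loads ⟺ the same state).  (5) «It remains only to show that this unique
critical point is a minimizer. The (negative of the) Hessian matrix of `C` is given by the matrix of
coefficients in (4.5). Since the bottom-right block of this matrix is negative definite, it follows by
Schur complements that the Hessian is positive definite if and only if `−(B_red + [b_shunt])` is positive
definite» — §2 **`costMatrix_posDef_iff`** (both directions, Mathlib's `schur_complement_eq₂₂`) and the
completed square `C(E) − C(E⁰) = (E − E⁰)ᵀ𝒜(E − E⁰)` at a critical point (`optCost_sub_eq_quadForm`),
whence **`optCost_lt_of_ne`**: the critical point is the STRICT GLOBAL minimiser of `C` on all of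
`ℝ^{n+m}` (a fortiori on `ℝ^{n+m}_{>0}`, where it lies).  §5 assembles **`proposition_4_1`** (matrix-level
data as Proposition 7.2 states them) and **`proposition_4_1_of_network`** (branch data, Lemma 7.1).

ON HYPOTHESIS (ii) OF THEOREM 3.3 AT `I_shunt = 0`.  The print treats `B_redE_L* < 0` as automatic
(§3.3: «since `B_redE_L* < 0_n` component-wise»).  What the data give is `B_redE_L* ≤ 0`
(`redSource_nonpos`), with STRICT inequality at every load bus that has a line to some inverter
(`redSource_neg_of_exists_line`; e.g. every load bus of a network whose loads hang off inverter
buses) — a load bus connected to the rest of the network only through other load buses has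
`(B_redE_L*)_l = 0`.  The assembled statements therefore carry `B_redE_L* < 0` as an explicit
hypothesis (it is only used for the POSITIVITY `E^Z ∈ ℝ^{n+m}_{>0}` and the stability clause quoted
from Theorem 3.3; the minimiser / critical-point statements do not need it).

THREE COLUMNS / NOT CLAIMED.  Statements about the MODEL of the companions (decoupled reactive power
flow, quadratic droop, constant-impedance loads) and about the finite-dimensional quadratic programme
(4.3); «unique minimizer» is typed as the strict global minimiser on `ℝ^{n+m}` of the cost DEFINED by
(4.1)–(4.3) in the print's vector notation; no claim about system-theoretic optimality of the controller
(the print: «We do not address system-theoretic optimality»), Remark 6 (generalised objectives) or §4.2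
(power sharing).  Nothing here says a microgrid is stable or optimal.

## Mathlib / tree search

Tree (used by name): companions (`closedLoop`, `IsEquilibrium`, `isEquilibrium_iff_reducedPowerFlow`,
`invVoltage`, `loadRow_of_invVoltage`, `Bred`, `redSource`, `ELstar`, `Bred_mulVec_ELstar`, `ziLoad`,
`ziVoltage`, `ziState`, `ziVoltage_reducedPowerFlow`, `eq_ziVoltage_of_reducedPowerFlow`,
`BLI_conjTranspose`, `Bred_transpose`, `isUnit_BIIK_det_of_posDef`, `posDef_neg_BIIK_of_posDef_aug`,
`theorem_3_3_originalNetwork`, `theorem_3_3_locallyExpStable`, `proposition_7_2`,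
`posDef_isZMatrix_inv_nonneg`, `susceptanceMatrix_*`, `posDef_neg_aug_of_branchConnected`,
`stieltjes_neg_Bred`).  Mathlib: `Matrix.schur_complement_eq₂₂`, `IsHermitian.fromBlocks₂₂`,
`Matrix.fromBlocks_mulVec`, `Fintype.sum_sum_type`, `hasFDerivAt_apply`, `HasFDerivAt.fun_sum`.

## References

* J. W. Simpson-Porco, F. Dörfler, F. Bullo, *Voltage stabilization in microgrids via quadratic droop
  control*, IEEE Trans. Automat. Control 62 (2017) 1239–1253 = arXiv:1507.00431: §4.1 eqs. (4.1)–(4.6)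
  and Proposition 4.1 with proof (held text p0013 L1 – p0014 L10); §3.3 Theorem 3.3; §7 Lemma 7.1 /
  Proposition 7.2. [SimpsonporcoDorflerBullo2017]
* S. Boyd, L. Vandenberghe, *Convex Optimization*, CUP 2004, §A.5.5 (Schur complement).
  [BoydVandenberghe2004]

AI-produced formalisation (LADDER-GRIDFUSION seat gridfusion-lit-2 g15, 2026-08-28).
-/

noncomputable section

open Finset Filter Set
open scoped Matrix BigOperators Topology

namespace Literature.MathematicalPhysics.PowerSystems

open _root_.Matrix Literature.LinearAlgebra.Matrix
open Literature.MathematicalPhysics.KineticTheory.HeatConduction (IsHurwitz)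

namespace QuadDroopNetwork

variable {n m : ℕ} (W : QuadDroopNetwork n m)

/-! ## §1 The cost functional (4.1)–(4.3) in the print's vector notation -/

/-- **Reactive power absorbed by the lines**, vector notation of the proof: `𝒬_loss(E) = −EᵀBE`.
[cite: SimpsonporcoDorflerBullo2017, §4.1 (p0013 L11–L16: «`𝒬_loss(E_L,E_I) = Σ_{{i,j}∈ℰ} B_ij(E_i − E_j)²`») and proof of Proposition 4.1 («In vector notation, we have that `𝒬_loss = −EᵀBE`»)] -/
def Qloss (E : Fin n ⊕ Fin m → ℝ) : ℝ := -(E ⬝ᵥ W.B *ᵥ E)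

/-- **Reactive power consumed by the constant-impedance loads**: `𝒬_load(E_L) = −Σ_l b_shunt,l E_l²`.
[cite: SimpsonporcoDorflerBullo2017, §4.1 eq. (4.1) and the display after it (p0013 L18–L23)] -/
def Qload (bsh : Fin n → ℝ) (E : Fin n ⊕ Fin m → ℝ) : ℝ := -∑ l, bsh l * E (Sum.inl l) ^ 2

/-- **Voltage-deviation cost** `C_volt(E_I) = −Σ_i κ_i(E_i − E_i*)²` (`κ_i < 0` in print).
[cite: SimpsonporcoDorflerBullo2017, §4.1 eq. (4.2) (p0013 L28–L32)] -/
def Cvolt (κ : Fin m → ℝ) (E : Fin n ⊕ Fin m → ℝ) : ℝ := -∑ i, κ i * (E (Sum.inr i) - W.Estar i) ^ 2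

/-- **The total cost of the optimization problem (4.3)**: `C = 𝒬_loss(E) + 𝒬_load(E_L) + C_volt(E_I)`.
[cite: SimpsonporcoDorflerBullo2017, §4.1 eq. (4.3) (p0013 L33–L37)] -/
def optCost (bsh : Fin n → ℝ) (κ : Fin m → ℝ) (E : Fin n ⊕ Fin m → ℝ) : ℝ :=
  W.Qloss E + Qload bsh E + W.Cvolt κ E

/-- **`−EᵀBE` IS the printed edge sum**: for the susceptance matrix of an inductive network with
symmetric branch susceptance magnitudes `w_ij`, `𝒬_loss(E) = ½ Σ_i Σ_j w_ij (E_i − E_j)² =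
Σ_{{i,j} ∈ ℰ} B_ij(E_i − E_j)²` (each unordered pair once). [cite: SimpsonporcoDorflerBullo2017, §4.1 (p0013 L11–L16) and §7 Lemma 7.1 (ii)] -/
theorem Qloss_eq_edgeSum {w : Fin n ⊕ Fin m → Fin n ⊕ Fin m → ℝ} (hw : ∀ i j, w i j = w j i)
    (hBw : W.B = susceptanceMatrix w) (E : Fin n ⊕ Fin m → ℝ) :
    W.Qloss E = (1 / 2) * ∑ k, ∑ k', w k k' * (E k - E k') ^ 2 := by
  rw [Qloss, hBw, dotProduct_susceptanceMatrix_mulVec hw]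
  ring

/-! ## §2 The quadratic form: `C(E) = Eᵀ𝒜E − 2Eᵀc − E_I*ᵀK_IE_I*`, its gradient, its Hessian, and
the Schur-complement criterion -/

/-- **The (negated) matrix of coefficients of (4.5) = half the Hessian of `C`**:
`𝒜 = −(B + blkdiag([b_shunt], [κ]))`.
[cite: SimpsonporcoDorflerBullo2017, proof of Proposition 4.1, eq. (4.5) and «The (negative of the) Hessian matrix of `C` is given by the matrix of coefficients in (4.5)» (p0014 L4–L6)] -/
def costMatrix (bsh : Fin n → ℝ) (κ : Fin m → ℝ) : Matrix (Fin n ⊕ Fin m) (Fin n ⊕ Fin m) ℝ :=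
  -(W.B + Matrix.fromBlocks (diagonal bsh) 0 0 (diagonal κ))

/-- The right-hand side of (4.5), negated: `c = (0, −[κ]E_I*)`.
[cite: SimpsonporcoDorflerBullo2017, proof of Proposition 4.1, eq. (4.5) (right-hand side `(0_n, K_IE_I*)`)] -/
def costSource (κ : Fin m → ℝ) : Fin n ⊕ Fin m → ℝ := Sum.elim 0 fun i => -(κ i * W.Estar i)

/-- Load rows of `𝒜E`. [cite: SimpsonporcoDorflerBullo2017, proof of Proposition 4.1, eq. (4.5)] -/
theorem costMatrix_mulVec_inl (bsh : Fin n → ℝ) (κ : Fin m → ℝ) (E : Fin n ⊕ Fin m → ℝ) (l : Fin n) :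
    (W.costMatrix bsh κ *ᵥ E) (Sum.inl l) = -((W.B *ᵥ E) (Sum.inl l) + bsh l * E (Sum.inl l)) := by
  simp only [costMatrix, neg_mulVec, add_mulVec, Pi.neg_apply, Pi.add_apply, fromBlocks_mulVec,
    Sum.elim_inl, zero_mulVec, add_zero, mulVec_diagonal, Function.comp_apply]

/-- Inverter rows of `𝒜E`. [cite: SimpsonporcoDorflerBullo2017, proof of Proposition 4.1, eq. (4.5)] -/
theorem costMatrix_mulVec_inr (bsh : Fin n → ℝ) (κ : Fin m → ℝ) (E : Fin n ⊕ Fin m → ℝ) (i : Fin m) :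
    (W.costMatrix bsh κ *ᵥ E) (Sum.inr i) = -((W.B *ᵥ E) (Sum.inr i) + κ i * E (Sum.inr i)) := by
  simp only [costMatrix, neg_mulVec, add_mulVec, Pi.neg_apply, Pi.add_apply, fromBlocks_mulVec,
    Sum.elim_inr, zero_mulVec, zero_add, mulVec_diagonal, Function.comp_apply]

/-- `Eᵀc = −Σ_i κ_iE_i*E_i`. [cite: SimpsonporcoDorflerBullo2017, proof of Proposition 4.1, eq. (4.5)] -/
theorem dotProduct_costSource (κ : Fin m → ℝ) (E : Fin n ⊕ Fin m → ℝ) :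
    E ⬝ᵥ W.costSource κ = -∑ i, κ i * W.Estar i * E (Sum.inr i) := by
  simp only [dotProduct, Fintype.sum_sum_type, costSource, Sum.elim_inl, Sum.elim_inr, Pi.zero_apply,
    mul_zero, Finset.sum_const_zero, zero_add, mul_neg, Finset.sum_neg_distrib]
  congr 1
  exact Finset.sum_congr rfl fun i _ => by ring

/-- `Eᵀ𝒜E = −EᵀBE − Σ_l b_lE_l² − Σ_i κ_iE_i²`. [cite: SimpsonporcoDorflerBullo2017, proof of Proposition 4.1 («the total cost `C` may therefore be written as the quadratic form …»)] -/
theorem dotProduct_costMatrix_mulVec (bsh : Fin n → ℝ) (κ : Fin m → ℝ) (E : Fin n ⊕ Fin m → ℝ) :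
    E ⬝ᵥ W.costMatrix bsh κ *ᵥ E
      = -(E ⬝ᵥ W.B *ᵥ E) - ∑ l, bsh l * E (Sum.inl l) ^ 2 - ∑ i, κ i * E (Sum.inr i) ^ 2 := by
  have h1 : E ⬝ᵥ W.costMatrix bsh κ *ᵥ E
      = ∑ l, E (Sum.inl l) * (W.costMatrix bsh κ *ᵥ E) (Sum.inl l)
        + ∑ i, E (Sum.inr i) * (W.costMatrix bsh κ *ᵥ E) (Sum.inr i) := by
    rw [dotProduct, Fintype.sum_sum_type]
  have h2 : E ⬝ᵥ W.B *ᵥ E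
      = ∑ l, E (Sum.inl l) * (W.B *ᵥ E) (Sum.inl l) + ∑ i, E (Sum.inr i) * (W.B *ᵥ E) (Sum.inr i) := by
    rw [dotProduct, Fintype.sum_sum_type]
  rw [h1, h2]
  simp only [costMatrix_mulVec_inl, costMatrix_mulVec_inr]
  have h3 : ∑ l, E (Sum.inl l) * -((W.B *ᵥ E) (Sum.inl l) + bsh l * E (Sum.inl l))
      = -∑ l, E (Sum.inl l) * (W.B *ᵥ E) (Sum.inl l) - ∑ l, bsh l * E (Sum.inl l) ^ 2 := by
    have e : ∀ l, E (Sum.inl l) * -((W.B *ᵥ E) (Sum.inl l) + bsh l * E (Sum.inl l))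
        = -(E (Sum.inl l) * (W.B *ᵥ E) (Sum.inl l)) - bsh l * E (Sum.inl l) ^ 2 := fun l => by ring
    simp only [e, Finset.sum_sub_distrib, Finset.sum_neg_distrib]
  have h4 : ∑ i, E (Sum.inr i) * -((W.B *ᵥ E) (Sum.inr i) + κ i * E (Sum.inr i))
      = -∑ i, E (Sum.inr i) * (W.B *ᵥ E) (Sum.inr i) - ∑ i, κ i * E (Sum.inr i) ^ 2 := by
    have e : ∀ i, E (Sum.inr i) * -((W.B *ᵥ E) (Sum.inr i) + κ i * E (Sum.inr i))
        = -(E (Sum.inr i) * (W.B *ᵥ E) (Sum.inr i)) - κ i * E (Sum.inr i) ^ 2 := fun i => by ring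
    simp only [e, Finset.sum_sub_distrib, Finset.sum_neg_distrib]
  rw [h3, h4]
  ring

/-- **The cost as a quadratic form**: `C(E) = Eᵀ𝒜E − 2Eᵀc − Σ_i κ_i(E_i*)²` («the total cost `C` may
therefore be written as the quadratic form `C = xᵀ𝓑x`, where `x = (E_L, E_I, E_I*)`»).
[cite: SimpsonporcoDorflerBullo2017, proof of Proposition 4.1 (p0013 L52–L58)] -/
theorem optCost_eq_quadForm (bsh : Fin n → ℝ) (κ : Fin m → ℝ) (E : Fin n ⊕ Fin m → ℝ) :
    W.optCost bsh κ E
      = E ⬝ᵥ W.costMatrix bsh κ *ᵥ E - 2 * (E ⬝ᵥ W.costSource κ) - ∑ i, κ i * W.Estar i ^ 2 := by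
  rw [dotProduct_costMatrix_mulVec, dotProduct_costSource, optCost, Qloss, Qload, Cvolt]
  have h : ∑ i, κ i * (E (Sum.inr i) - W.Estar i) ^ 2
      = ∑ i, κ i * E (Sum.inr i) ^ 2 - 2 * ∑ i, κ i * W.Estar i * E (Sum.inr i)
        + ∑ i, κ i * W.Estar i ^ 2 := by
    rw [Finset.mul_sum, ← Finset.sum_sub_distrib, ← Finset.sum_add_distrib]
    exact Finset.sum_congr rfl fun i _ => by ring
  rw [h]
  ring

variable {W} in
/-- `𝒜` is symmetric when `B` is. [cite: SimpsonporcoDorflerBullo2017, §7 Lemma 7.1 (i) (`B_ij = B_ji`)] -/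
theorem costMatrix_transpose (hB : W.B.IsSymm) (bsh : Fin n → ℝ) (κ : Fin m → ℝ) :
    (W.costMatrix bsh κ)ᵀ = W.costMatrix bsh κ := by
  rw [costMatrix, transpose_neg, transpose_add, hB.eq, fromBlocks_transpose, diagonal_transpose,
    diagonal_transpose, transpose_zero, transpose_zero]

variable {W} in
/-- `E⁰ᵀ𝒜E = (𝒜E⁰)ᵀE` for symmetric `𝒜`. [folklore] -/
private theorem dotProduct_costMatrix_mulVec_comm (hB : W.B.IsSymm) (bsh : Fin n → ℝ) (κ : Fin m → ℝ)
    (x y : Fin n ⊕ Fin m → ℝ) :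
    x ⬝ᵥ W.costMatrix bsh κ *ᵥ y = (W.costMatrix bsh κ *ᵥ x) ⬝ᵥ y := by
  rw [dotProduct_mulVec, ← mulVec_transpose, costMatrix_transpose hB]

variable {W} in
/-- **Completing the square at a critical point**: if `𝒜E⁰ = c` and `B` is symmetric, then
`C(E) − C(E⁰) = (E − E⁰)ᵀ𝒜(E − E⁰)` for every `E`.
[cite: SimpsonporcoDorflerBullo2017, proof of Proposition 4.1 («It remains only to show that this unique critical point is a minimizer. The (negative of the) Hessian matrix of `C` is given by the matrix of coefficients in (4.5)», p0014 L4–L6)] -/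
theorem optCost_sub_eq_quadForm (hB : W.B.IsSymm) (bsh : Fin n → ℝ) (κ : Fin m → ℝ)
    {E₀ : Fin n ⊕ Fin m → ℝ} (h₀ : W.costMatrix bsh κ *ᵥ E₀ = W.costSource κ) (E : Fin n ⊕ Fin m → ℝ) :
    W.optCost bsh κ E - W.optCost bsh κ E₀
      = (E - E₀) ⬝ᵥ W.costMatrix bsh κ *ᵥ (E - E₀) := by
  rw [optCost_eq_quadForm, optCost_eq_quadForm]
  have h1 : E₀ ⬝ᵥ W.costMatrix bsh κ *ᵥ E₀ = E₀ ⬝ᵥ W.costSource κ := by rw [h₀]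
  have h2 : E ⬝ᵥ W.costMatrix bsh κ *ᵥ E₀ = E ⬝ᵥ W.costSource κ := by rw [h₀]
  have h3 : E₀ ⬝ᵥ W.costMatrix bsh κ *ᵥ E = E ⬝ᵥ W.costSource κ := by
    rw [dotProduct_costMatrix_mulVec_comm hB, h₀, dotProduct_comm]
  rw [mulVec_sub, dotProduct_sub, sub_dotProduct, sub_dotProduct, h1, h2, h3]
  ring

variable {W} in
/-- **Strict global minimality at a critical point with positive definite Hessian**: if `𝒜 ≻ 0` and
`𝒜E⁰ = c` then `C(E⁰) < C(E)` for every `E ≠ E⁰` — the critical point is the UNIQUE minimiser of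
(4.3) on all of `ℝ^{n+m}` (a fortiori on `ℝ^{n+m}_{>0}`).
[cite: SimpsonporcoDorflerBullo2017, Proposition 4.1 («the unique minimizer of the optimization problem (4.3)») and its proof (p0014 L4–L8)] -/
theorem optCost_lt_of_ne (hB : W.B.IsSymm) {bsh : Fin n → ℝ} {κ : Fin m → ℝ}
    (hA : (W.costMatrix bsh κ).PosDef) {E₀ : Fin n ⊕ Fin m → ℝ}
    (h₀ : W.costMatrix bsh κ *ᵥ E₀ = W.costSource κ) {E : Fin n ⊕ Fin m → ℝ} (hne : E ≠ E₀) :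
    W.optCost bsh κ E₀ < W.optCost bsh κ E := by
  have h := optCost_sub_eq_quadForm hB bsh κ h₀ E
  have hpos : 0 < (E - E₀) ⬝ᵥ W.costMatrix bsh κ *ᵥ (E - E₀) := by
    have := hA.dotProduct_mulVec_pos (sub_ne_zero.2 hne)
    rwa [star_trivial] at this
  linarith

variable {W} in
/-- Consequently a minimiser of `C` (even a point where `C` does not exceed `C(E⁰)`) IS the critical
point. [cite: SimpsonporcoDorflerBullo2017, Proposition 4.1 («the unique minimizer»)] -/
theorem eq_of_optCost_le (hB : W.B.IsSymm) {bsh : Fin n → ℝ} {κ : Fin m → ℝ}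
    (hA : (W.costMatrix bsh κ).PosDef) {E₀ : Fin n ⊕ Fin m → ℝ}
    (h₀ : W.costMatrix bsh κ *ᵥ E₀ = W.costSource κ) {E : Fin n ⊕ Fin m → ℝ}
    (hle : W.optCost bsh κ E ≤ W.optCost bsh κ E₀) : E = E₀ := by
  by_contra hne
  exact absurd hle (not_le.2 (optCost_lt_of_ne hB hA h₀ hne))

/-! ### The gradient: `∇C(E) = 2(𝒜E − c)` and the first-order condition (4.5) -/

/-- The quadratic form `v ↦ vᵀQv` on `ℝ^ι` has Fréchet derivative `u ↦ xᵀQu + (Qx)ᵀu` at `x`.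
[folklore] -/
private theorem hasFDerivAt_quadForm {ι : Type*} [Fintype ι] [DecidableEq ι] (Q : Matrix ι ι ℝ)
    (x : ι → ℝ) :
    ∃ D : (ι → ℝ) →L[ℝ] ℝ, HasFDerivAt (fun v : ι → ℝ => v ⬝ᵥ Q *ᵥ v) D x ∧
      ∀ u, D u = x ⬝ᵥ Q *ᵥ u + (Q *ᵥ x) ⬝ᵥ u := by
  set T : (ι → ℝ) →L[ℝ] (ι → ℝ) := LinearMap.toContinuousLinearMap (Matrix.mulVecLin Q) with hTdef
  have hT : ∀ v, T v = Q *ᵥ v := fun v => by simp [hTdef]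
  set P : ι → (ι → ℝ) →L[ℝ] ℝ := fun i => ContinuousLinearMap.proj i with hPdef
  have hP : ∀ i (v : ι → ℝ), P i v = v i := fun i v => rfl
  refine ⟨∑ i, (x i • ((P i).comp T) + (T x) i • P i), ?_, ?_⟩
  · have h : ∀ i ∈ (Finset.univ : Finset ι), HasFDerivAt (fun v : ι → ℝ => v i * (T v) i)
        (x i • ((P i).comp T) + (T x) i • P i) x := by
      intro i _
      have h1 : HasFDerivAt (fun v : ι → ℝ => v i) (P i) x := hasFDerivAt_apply i x
      have h2 : HasFDerivAt (fun v : ι → ℝ => (T v) i) ((P i).comp T) x :=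
        ((P i).comp T).hasFDerivAt
      exact h1.fun_mul h2
    have hs := HasFDerivAt.fun_sum h
    have hfun : (fun v : ι → ℝ => v ⬝ᵥ Q *ᵥ v) = fun y => ∑ i, y i * (T y) i := by
      funext y
      simp only [hT, dotProduct]
    rw [hfun]
    exact hs
  · intro u
    simp only [_root_.sum_apply, _root_.add_apply, _root_.smul_apply, ContinuousLinearMap.comp_apply,
      hT, hP, smul_eq_mul, dotProduct, Finset.sum_add_distrib]

/-- A linear functional `v ↦ vᵀw₀` is its own derivative. [folklore] -/
private theorem hasFDerivAt_dotProduct_const {ι : Type*} [Fintype ι] (w₀ x : ι → ℝ) :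
    ∃ L : (ι → ℝ) →L[ℝ] ℝ, HasFDerivAt (fun v : ι → ℝ => v ⬝ᵥ w₀) L x ∧ ∀ u, L u = u ⬝ᵥ w₀ := by
  refine ⟨∑ i, w₀ i • (ContinuousLinearMap.proj i : (ι → ℝ) →L[ℝ] ℝ), ?_, fun u => ?_⟩
  · have h : ∀ i ∈ (Finset.univ : Finset ι), HasFDerivAt (fun v : ι → ℝ => v i * w₀ i)
        (w₀ i • (ContinuousLinearMap.proj i : (ι → ℝ) →L[ℝ] ℝ)) x :=
      fun i _ => (hasFDerivAt_apply i x).mul_const (w₀ i)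
    have hs := HasFDerivAt.fun_sum h
    have hfun : (fun v : ι → ℝ => v ⬝ᵥ w₀) = fun v => ∑ i, v i * w₀ i := by
      funext v; rfl
    rw [hfun]; exact hs
  · simp only [_root_.sum_apply, _root_.smul_apply, ContinuousLinearMap.proj_apply, smul_eq_mul,
      dotProduct]
    exact Finset.sum_congr rfl fun i _ => mul_comm _ _

variable {W} in
/-- **The gradient of the cost**: for symmetric `B`, `C` is differentiable at every `E` with
`∇C(E)h = 2hᵀ(𝒜E − c)`.
[cite: SimpsonporcoDorflerBullo2017, proof of Proposition 4.1 («The first order optimality conditions `∇C(E) = 0_{n+m}` yield (4.5)», p0013 L59 – p0014 L1)] -/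
theorem hasFDerivAt_optCost (hB : W.B.IsSymm) (bsh : Fin n → ℝ) (κ : Fin m → ℝ)
    (E : Fin n ⊕ Fin m → ℝ) :
    ∃ D : (Fin n ⊕ Fin m → ℝ) →L[ℝ] ℝ, HasFDerivAt (W.optCost bsh κ) D E ∧
      ∀ h, D h = 2 * (h ⬝ᵥ (W.costMatrix bsh κ *ᵥ E - W.costSource κ)) := by
  obtain ⟨D₁, hD₁, hD₁u⟩ := hasFDerivAt_quadForm (W.costMatrix bsh κ) E
  obtain ⟨D₂, hD₂, hD₂u⟩ := hasFDerivAt_dotProduct_const (W.costSource κ) E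
  refine ⟨D₁ - (2 : ℝ) • D₂, ?_, fun h => ?_⟩
  · have hsum := (hD₁.sub (hD₂.const_smul (2 : ℝ))).sub_const (∑ i, κ i * W.Estar i ^ 2)
    refine (hsum.congr_of_eventuallyEq (Eventually.of_forall fun E' => ?_)).congr_fderiv rfl
    simp only [Pi.sub_apply, Pi.smul_apply, smul_eq_mul, optCost_eq_quadForm]
  · rw [_root_.sub_apply, _root_.smul_apply, hD₁u, hD₂u, smul_eq_mul,
      dotProduct_costMatrix_mulVec_comm hB, dotProduct_sub, dotProduct_comm (W.costMatrix bsh κ *ᵥ E) h]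
    ring

variable {W} in
/-- **First-order optimality condition ⟺ (4.5)**: the derivative `h ↦ 2hᵀ(𝒜E − c)` vanishes iff
`𝒜E = c`, i.e. iff `[B_LL + [b_shunt], B_LI; B_IL, B_II + [κ]](E_L, E_I) = (0, [κ]E_I*)`.
[cite: SimpsonporcoDorflerBullo2017, proof of Proposition 4.1, eq. (4.5)] -/
theorem fderiv_optCost_eq_zero_iff {bsh : Fin n → ℝ} {κ : Fin m → ℝ} {E : Fin n ⊕ Fin m → ℝ}
    {D : (Fin n ⊕ Fin m → ℝ) →L[ℝ] ℝ}
    (hD : ∀ h, D h = 2 * (h ⬝ᵥ (W.costMatrix bsh κ *ᵥ E - W.costSource κ))) :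
    D = 0 ↔ W.costMatrix bsh κ *ᵥ E = W.costSource κ := by
  constructor
  · intro h0
    have hv : ∀ h : Fin n ⊕ Fin m → ℝ, h ⬝ᵥ (W.costMatrix bsh κ *ᵥ E - W.costSource κ) = 0 := by
      intro h
      have := hD h
      rw [h0, _root_.zero_apply] at this
      linarith
    have hself := hv (W.costMatrix bsh κ *ᵥ E - W.costSource κ)
    rw [dotProduct_self_eq_zero] at hself
    exact sub_eq_zero.1 hself
  · intro hc
    ext h
    rw [hD, hc, sub_self, dotProduct_zero, mul_zero, _root_.zero_apply]

/-- **(4.5) spelled out in blocks**: `𝒜E = c` iff `(B_LL + [b_shunt])E_L + B_LIE_I = 0` and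
`B_ILE_L + (B_II + [κ])E_I = [κ]E_I*`.
[cite: SimpsonporcoDorflerBullo2017, proof of Proposition 4.1, eq. (4.5) (p0014 L1–L2)] -/
theorem firstOrder_iff_blocks (bsh : Fin n → ℝ) (κ : Fin m → ℝ) (E : Fin n ⊕ Fin m → ℝ) :
    W.costMatrix bsh κ *ᵥ E = W.costSource κ ↔
      (∀ l, (W.B *ᵥ E) (Sum.inl l) + bsh l * E (Sum.inl l) = 0) ∧
      (∀ i, (W.B *ᵥ E) (Sum.inr i) + κ i * E (Sum.inr i) = κ i * W.Estar i) := by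
  constructor
  · intro h
    refine ⟨fun l => ?_, fun i => ?_⟩
    · have hl := congrFun h (Sum.inl l)
      rw [costMatrix_mulVec_inl, costSource, Sum.elim_inl, Pi.zero_apply] at hl
      linarith
    · have hi := congrFun h (Sum.inr i)
      rw [costMatrix_mulVec_inr, costSource, Sum.elim_inr] at hi
      linarith
  · rintro ⟨hL, hI⟩
    funext k
    cases k with
    | inl l => rw [costMatrix_mulVec_inl, costSource, Sum.elim_inl, Pi.zero_apply, hL l, neg_zero]
    | inr i => rw [costMatrix_mulVec_inr, costSource, Sum.elim_inr, hI i]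

/-! ### The Hessian and the Schur complement: `𝒜 ≻ 0 ⟺ −(B_red + [b_shunt]) ≻ 0` -/

/-- Entries of the blocks (restated; private in the companions). [folklore] -/
private theorem BLL_apply' (l l' : Fin n) : W.BLL l l' = W.B (Sum.inl l) (Sum.inl l') := rfl
/-- Entries of the blocks (restated; private in the companions). [folklore] -/
private theorem BLI_apply' (l : Fin n) (i : Fin m) : W.BLI l i = W.B (Sum.inl l) (Sum.inr i) := rfl
/-- Entries of the blocks (restated; private in the companions). [folklore] -/
private theorem BIL_apply' (i : Fin m) (l : Fin n) : W.BIL i l = W.B (Sum.inr i) (Sum.inl l) := rfl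
/-- Entries of the blocks (restated; private in the companions). [folklore] -/
private theorem BII_apply' (i i' : Fin m) : W.BII i i' = W.B (Sum.inr i) (Sum.inr i') := rfl

/-- `(−M)⁻¹ = −M⁻¹` for an invertible matrix. [folklore] -/
private theorem inv_neg_eq' {ι : Type*} [Fintype ι] [DecidableEq ι] {M : Matrix ι ι ℝ}
    (hM : IsUnit M.det) : (-M)⁻¹ = -M⁻¹ :=
  Matrix.inv_eq_left_inv (by rw [neg_mul_neg, Matrix.nonsing_inv_mul _ hM])

variable {W} in
/-- **`𝒜` in block form** (for `κ = K`): `𝒜 = [−(B_LL + [b]) −B_LI; (−B_LI)ᴴ −(B_II + K_I)]`.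
[cite: SimpsonporcoDorflerBullo2017, proof of Proposition 4.1, eq. (4.5)] -/
theorem costMatrix_eq_fromBlocks (hB : W.B.IsSymm) (bsh : Fin n → ℝ) :
    W.costMatrix bsh W.K
      = Matrix.fromBlocks (-(W.BLL + diagonal bsh)) (-W.BLI) (-W.BLI)ᴴ (-W.BIIK) := by
  rw [conjTranspose_neg, BLI_conjTranspose hB]
  ext k k'
  rcases k with l | i <;> rcases k' with l' | i'
  · simp [costMatrix, Matrix.fromBlocks_apply₁₁, BLL_apply', diagonal_apply]
    split_ifs <;> ring
  · simp [costMatrix, Matrix.fromBlocks_apply₁₂, BLI_apply']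
  · simp [costMatrix, Matrix.fromBlocks_apply₂₁, BIL_apply']
  · simp [costMatrix, Matrix.fromBlocks_apply₂₂, BIIK, BII_apply', diagonal_apply]
    split_ifs <;> ring

/-- **Schur-complement criterion, `₂₂` form, definite version**: `D ≻ 0` and `A − BD⁻¹Bᴴ ≻ 0` give
`[A B; Bᴴ D] ≻ 0`. [folklore] -/
private theorem posDef_fromBlocks_of_schur₂₂' {p q : Type*} [Fintype p] [Fintype q] [DecidableEq q]
    {A : Matrix p p ℝ} {B : Matrix p q ℝ} {D : Matrix q q ℝ} (hD : D.PosDef)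
    (hS : (A - B * D⁻¹ * Bᴴ).PosDef) : (Matrix.fromBlocks A B Bᴴ D).PosDef := by
  classical
  obtain ⟨hInv⟩ := hD.isUnit.nonempty_invertible
  rw [Matrix.posDef_iff_dotProduct_mulVec]
  refine ⟨(IsHermitian.fromBlocks₂₂ A B hD.1).2 hS.1, fun v hv => ?_⟩
  rw [← Sum.elim_comp_inl_inr v, Matrix.dotProduct_mulVec,
    Matrix.schur_complement_eq₂₂ A B _ _ hD.1, ← Matrix.dotProduct_mulVec, ← Matrix.dotProduct_mulVec]
  set x : p → ℝ := v ∘ Sum.inl with hx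
  set y : q → ℝ := v ∘ Sum.inr with hy
  set z : q → ℝ := (D⁻¹ * Bᴴ) *ᵥ x + y with hz
  have hDz : 0 ≤ star z ⬝ᵥ (D *ᵥ z) := by
    simpa using hD.posSemidef.dotProduct_mulVec_nonneg z
  by_cases hx0 : x = 0
  · have hy0 : y ≠ 0 := by
      intro hy0
      apply hv
      rw [← Sum.elim_comp_inl_inr v]
      change Sum.elim x y = 0
      rw [hx0, hy0]
      funext k; cases k <;> rfl
    have hz' : z = y := by rw [hz, hx0, Matrix.mulVec_zero, zero_add]
    have hSx : star x ⬝ᵥ ((A - B * D⁻¹ * Bᴴ) *ᵥ x) = 0 := by rw [hx0]; simp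
    rw [hSx, add_zero, hz']
    exact hD.dotProduct_mulVec_pos hy0
  · exact add_pos_of_nonneg_of_pos hDz (hS.dotProduct_mulVec_pos hx0)

/-- **Schur complement of a positive definite block matrix, `₂₂` form**: `[A B; Bᴴ D] ≻ 0` with `D ≻ 0`
gives `A − BD⁻¹Bᴴ ≻ 0`. [folklore] -/
private theorem posDef_schur₂₂_of_posDef_fromBlocks' {p q : Type*} [Fintype p] [Fintype q]
    [DecidableEq q] {A : Matrix p p ℝ} {B : Matrix p q ℝ} {D : Matrix q q ℝ} (hD : D.PosDef)
    (hM : (Matrix.fromBlocks A B Bᴴ D).PosDef) : (A - B * D⁻¹ * Bᴴ).PosDef := by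
  classical
  obtain ⟨hInv⟩ := hD.isUnit.nonempty_invertible
  rw [Matrix.posDef_iff_dotProduct_mulVec]
  refine ⟨(IsHermitian.fromBlocks₂₂ A B hD.1).1 hM.1, fun x hx => ?_⟩
  set y : q → ℝ := -((D⁻¹ * Bᴴ) *ᵥ x) with hy
  have hv : Sum.elim x y ≠ 0 := by
    intro h0
    apply hx
    funext l
    exact congrFun h0 (Sum.inl l)
  have hform := (Matrix.posDef_iff_dotProduct_mulVec.1 hM).2 hv
  rw [Matrix.dotProduct_mulVec, Matrix.schur_complement_eq₂₂ A B x y hD.1] at hform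
  have hzero : (D⁻¹ * Bᴴ) *ᵥ x + y = 0 := by rw [hy]; abel
  rw [hzero, star_zero, Matrix.zero_vecMul, zero_dotProduct, zero_add,
    ← Matrix.dotProduct_mulVec] at hform
  exact hform

variable {W} in
/-- **«Since the bottom-right block of this matrix is negative definite, it follows by Schur
complements that the Hessian is positive definite if and only if `−(B_red + [b_shunt])` is positive
definite»** (for `κ = K`, `B` symmetric, `−(B_II + K_I) ≻ 0`).
[cite: SimpsonporcoDorflerBullo2017, proof of Proposition 4.1 (p0014 L6–L8); BoydVandenberghe2004, §A.5.5] -/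
theorem costMatrix_posDef_iff (hB : W.B.IsSymm) (hII : (-W.BIIK).PosDef) (bsh : Fin n → ℝ) :
    (W.costMatrix bsh W.K).PosDef ↔ (-(W.Bred + diagonal bsh)).PosDef := by
  classical
  have hUII : IsUnit W.BIIK.det := isUnit_BIIK_det_of_posDef hII
  have hLIH := BLI_conjTranspose hB
  -- the Schur complement w.r.t. the `II` block is `−(B_red + [b])`
  have hS : -(W.BLL + diagonal bsh) - -W.BLI * (-W.BIIK)⁻¹ * (-W.BLI)ᴴ = -(W.Bred + diagonal bsh) := by
    rw [conjTranspose_neg, hLIH, inv_neg_eq' hUII]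
    simp only [Matrix.neg_mul, Matrix.mul_neg, neg_neg, Bred]
    abel
  rw [costMatrix_eq_fromBlocks hB]
  constructor
  · intro h
    rw [← hS]
    exact posDef_schur₂₂_of_posDef_fromBlocks' hII h
  · intro h
    rw [← hS] at h
    exact posDef_fromBlocks_of_schur₂₂' hII h

/-! ## §3 Solving (4.5): the second block gives (3.8), the first block the reduced power flow
equation (4.6) = (3.12) with `I_shunt = 0`; the unique critical point is `(E_L^Z, W₂(E_L^Z, E_I*))` -/

/-- `B` is the block matrix of its four blocks. [folklore] -/
private theorem B_eq_fromBlocks'' : W.B = Matrix.fromBlocks W.BLL W.BLI W.BIL W.BII :=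
  (Matrix.fromBlocks_toBlocks W.B).symm

/-- Load rows of `BE`. [folklore] -/
private theorem B_mulVec_inl' (E : Fin n ⊕ Fin m → ℝ) (l : Fin n) :
    (W.B *ᵥ E) (Sum.inl l)
      = (W.BLL *ᵥ fun l' => E (Sum.inl l')) l + (W.BLI *ᵥ fun i => E (Sum.inr i)) l := by
  conv_lhs => rw [B_eq_fromBlocks'', Matrix.fromBlocks_mulVec]
  rfl

/-- Inverter rows of `BE`. [folklore] -/
private theorem B_mulVec_inr' (E : Fin n ⊕ Fin m → ℝ) (i : Fin m) :
    (W.B *ᵥ E) (Sum.inr i)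
      = (W.BIL *ᵥ fun l' => E (Sum.inl l')) i + (W.BII *ᵥ fun i' => E (Sum.inr i')) i := by
  conv_lhs => rw [B_eq_fromBlocks'', Matrix.fromBlocks_mulVec]
  rfl

variable {W} in
/-- **«Solving the second block of equations in (4.5) for `E_I` yields the quadratic droop inverter
voltages (3.8)»**: for `κ = K` and `B_II + K_I` invertible, the inverter rows of (4.5) hold iff
`E_I = W₂(E_L, E_I*)`. [cite: SimpsonporcoDorflerBullo2017, proof of Proposition 4.1 (p0014 L2–L3) and Theorem 3.1 eq. (3.8)] -/
theorem inverterRows_firstOrder_iff (hU : IsUnit W.BIIK.det) (E : Fin n ⊕ Fin m → ℝ) :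
    (∀ i, (W.B *ᵥ E) (Sum.inr i) + W.K i * E (Sum.inr i) = W.K i * W.Estar i) ↔
      (fun i => E (Sum.inr i)) = W.invVoltage fun l => E (Sum.inl l) := by
  have key : (∀ i, (W.B *ᵥ E) (Sum.inr i) + W.K i * E (Sum.inr i) = W.K i * W.Estar i) ↔
      W.BIIK *ᵥ (fun i => E (Sum.inr i))
        = diagonal W.K *ᵥ W.Estar - W.BIL *ᵥ fun l => E (Sum.inl l) := by
    constructor
    · intro h
      funext i
      have hi := h i
      rw [B_mulVec_inr'] at hi
      simp only [BIIK, add_mulVec, Pi.add_apply, Pi.sub_apply, mulVec_diagonal]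
      linarith
    · intro h i
      have hi := congrFun h i
      simp only [BIIK, add_mulVec, Pi.add_apply, Pi.sub_apply, mulVec_diagonal] at hi
      rw [B_mulVec_inr']
      linarith
  rw [key, invVoltage]
  constructor
  · intro h
    rw [← h, mulVec_mulVec, nonsing_inv_mul _ hU, one_mulVec]
  · intro h
    rw [h, mulVec_mulVec, mul_nonsing_inv _ hU, one_mulVec]

variable {W} in
/-- **«Substituting this into the first block of equations in (4.5), simplifying, and left-multiplying
by `[E_L]` yields (4.6) `0 = [E_L][b_shunt]E_L + [E_L]B_red(E_L − E_L*)` … exactly the reduced power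
flow equation (3.12) with `I_shunt = 0`»**: with `E_I = W₂(E_L, E_I*)`, the load rows of (4.5) hold iff
`(B_red + [b_shunt])E_L = B_redE_L*`. [cite: SimpsonporcoDorflerBullo2017, proof of Proposition 4.1, eq. (4.6) (p0014 L3–L10)] -/
theorem loadRows_firstOrder_iff (bsh : Fin n → ℝ) (EL : Fin n → ℝ) :
    (∀ l, (W.B *ᵥ Sum.elim EL (W.invVoltage EL)) (Sum.inl l) + bsh l * EL l = 0) ↔
      (W.Bred + diagonal bsh) *ᵥ EL = W.redSource := by
  have hrow : ∀ l, (W.B *ᵥ Sum.elim EL (W.invVoltage EL)) (Sum.inl l)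
      = (W.Bred *ᵥ EL) l - W.redSource l := by
    intro l
    rw [B_mulVec_inl']
    exact loadRow_of_invVoltage EL l
  constructor
  · intro h
    funext l
    have hl := h l
    rw [hrow] at hl
    rw [add_mulVec, Pi.add_apply, mulVec_diagonal]
    linarith
  · intro h l
    have hl := congrFun h l
    rw [add_mulVec, Pi.add_apply, mulVec_diagonal] at hl
    rw [hrow]
    linarith

variable {W} in
/-- `E_L^{ZI}` at `I_shunt = 0` solves `(B_red + [b])E_L = B_redE_L*`, and is its only solution when
`B_red + [b]` is invertible. [cite: SimpsonporcoDorflerBullo2017, Proposition 4.1 eq. (4.4) and Theorem 3.3 eq. (3.11) with `I_shunt = 0`] -/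
theorem Bsh_mulVec_eq_redSource_iff {bsh : Fin n → ℝ} (hUb : IsUnit (W.Bred + diagonal bsh).det)
    (EL : Fin n → ℝ) :
    (W.Bred + diagonal bsh) *ᵥ EL = W.redSource ↔ EL = W.ziVoltage bsh 0 := by
  constructor
  · intro h
    calc EL = ((W.Bred + diagonal bsh)⁻¹ * (W.Bred + diagonal bsh)) *ᵥ EL := by
          rw [nonsing_inv_mul _ hUb, one_mulVec]
      _ = W.ziVoltage bsh 0 := by rw [← mulVec_mulVec, h, ziVoltage, sub_zero]
  · intro h
    rw [h, ziVoltage, sub_zero, mulVec_mulVec, mul_nonsing_inv _ hUb, one_mulVec]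

variable {W} in
/-- **The unique critical point of `C` is `(E_L^Z, E_I^Z)`**: for `κ = K`, `B_II + K_I` and
`B_red + [b_shunt]` invertible, `𝒜E = c` iff `E = (E_L^Z, W₂(E_L^Z, E_I*))` with
`E_L^Z = (B_red + [b_shunt])⁻¹B_redE_L*` — the companion's `ziState b_shunt 0`.
[cite: SimpsonporcoDorflerBullo2017, Proposition 4.1 eq. (4.4) and its proof (p0014 L1–L10: «shows the desired correspondance»)] -/
theorem firstOrder_iff_eq_ziState (hU : IsUnit W.BIIK.det) {bsh : Fin n → ℝ}
    (hUb : IsUnit (W.Bred + diagonal bsh).det) (E : Fin n ⊕ Fin m → ℝ) :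
    W.costMatrix bsh W.K *ᵥ E = W.costSource W.K ↔ E = W.ziState bsh 0 := by
  rw [firstOrder_iff_blocks]
  constructor
  · rintro ⟨hL, hI⟩
    have hIv := (inverterRows_firstOrder_iff hU E).1 hI
    have hE : E = Sum.elim (fun l => E (Sum.inl l)) (W.invVoltage fun l => E (Sum.inl l)) := by
      rw [← hIv]
      exact (Sum.elim_comp_inl_inr E).symm
    have hL' : ∀ l, (W.B *ᵥ Sum.elim (fun l => E (Sum.inl l)) (W.invVoltage fun l => E (Sum.inl l)))
        (Sum.inl l) + bsh l * E (Sum.inl l) = 0 := by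
      intro l
      rw [← hE]
      exact hL l
    have hEL := (Bsh_mulVec_eq_redSource_iff hUb _).1 ((loadRows_firstOrder_iff bsh _).1 hL')
    rw [hE, hEL]
    rfl
  · intro hE
    subst hE
    have hIv : (fun i => W.ziState bsh 0 (Sum.inr i))
        = W.invVoltage fun l => W.ziState bsh 0 (Sum.inl l) := rfl
    refine ⟨?_, (inverterRows_firstOrder_iff hU _).2 hIv⟩
    have h := (loadRows_firstOrder_iff bsh (W.ziVoltage bsh 0)).2
      ((Bsh_mulVec_eq_redSource_iff hUb _).2 rfl)
    exact h

/-! ## §4 Equilibria of the closed loop (3.3) with constant-impedance loads ⟺ critical points of `C` -/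

variable {W} in
/-- **Positive equilibria of (3.3) with Z loads are exactly the state `(E_L^Z, E_I^Z)`** (Theorem 3.1
+ Theorem 3.3 at `I_shunt = 0`: the reduced power flow equation with Z loads and positive load voltages
has the unique solution `E_L^Z`). [cite: SimpsonporcoDorflerBullo2017, Proposition 4.1 («the unique … equilibrium `(E_L^Z, E_I^Z)` … of the closed-loop system (3.3)») with Theorem 3.1 and Theorem 3.3] -/
theorem isEquilibrium_zLoads_iff_eq_ziState (hU : IsUnit W.BIIK.det) {bsh : Fin n → ℝ}
    (hUb : IsUnit (W.Bred + diagonal bsh).det) {E : Fin n ⊕ Fin m → ℝ} (hE : ∀ k, 0 < E k) :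
    W.IsEquilibrium (ziLoad bsh 0) E ↔ E = W.ziState bsh 0 := by
  rw [isEquilibrium_iff_reducedPowerFlow hU (ziLoad bsh 0) (fun i => hE (Sum.inr i))]
  constructor
  · rintro ⟨hR, hI⟩
    have hEL := eq_ziVoltage_of_reducedPowerFlow hUb (fun l => (hE (Sum.inl l)).ne') hR
    calc E = Sum.elim (fun l => E (Sum.inl l)) (fun i => E (Sum.inr i)) :=
          (Sum.elim_comp_inl_inr E).symm
      _ = W.ziState bsh 0 := by rw [hI, hEL]; rfl
  · intro h
    subst h
    exact ⟨ziVoltage_reducedPowerFlow hUb, rfl⟩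

variable {W} in
/-- **«The first order optimality conditions `∇C(E) = 0` yield (4.5) … exactly the reduced power flow
equation»**: for a state with positive voltages, `E` is an equilibrium of the closed loop (3.3) with
constant-impedance loads iff `E` is a critical point of `C` (`𝒜E = c`, `κ = K`).
[cite: SimpsonporcoDorflerBullo2017, proof of Proposition 4.1 (p0013 L59 – p0014 L10)] -/
theorem isEquilibrium_zLoads_iff_firstOrder (hU : IsUnit W.BIIK.det) {bsh : Fin n → ℝ}
    (hUb : IsUnit (W.Bred + diagonal bsh).det) {E : Fin n ⊕ Fin m → ℝ} (hE : ∀ k, 0 < E k) :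
    W.IsEquilibrium (ziLoad bsh 0) E ↔ W.costMatrix bsh W.K *ᵥ E = W.costSource W.K := by
  rw [isEquilibrium_zLoads_iff_eq_ziState hU hUb hE, firstOrder_iff_eq_ziState hU hUb]

/-! ## §5 Hypothesis (ii) of Theorem 3.3 at `I_shunt = 0`, and Proposition 4.1 assembled -/

variable {W} in
/-- The inverter-side vector `u = (B_II + K_I)⁻¹[K]E_I*` is POSITIVE when `−(B_II + K_I)` is a
Stieltjes matrix, `K_i < 0`, `E_i* > 0` (inverse-positivity: `(−(B_II + K_I))⁻¹ ≥ 0` with positive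
diagonal, applied to the positive vector `−[K]E_I*`). [cite: SimpsonporcoDorflerBullo2017, §7 Proposition 7.2 (proof: inverse-positivity of the Stieltjes matrix `−(B_II + K_I)`); BermanPlemmons1994, Ch. 6 Thm. 2.3 (N₃₈)] -/
theorem BIIK_inv_mulVec_K_Estar_pos (hoff : ∀ k k', k ≠ k' → 0 ≤ W.B k k')
    (hII : (-W.BIIK).PosDef) (hK : ∀ i, W.K i < 0) (hEs : ∀ i, 0 < W.Estar i) (i : Fin m) :
    0 < (W.BIIK⁻¹ *ᵥ (diagonal W.K *ᵥ W.Estar)) i := by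
  classical
  have hZII : IsZMatrix (-W.BIIK) := by
    intro i i' hii'
    rw [Matrix.neg_apply, neg_nonpos, BIIK, Matrix.add_apply, BII_apply',
      Matrix.diagonal_apply_ne _ hii', add_zero]
    exact hoff _ _ (by simpa using hii')
  have hUII : IsUnit W.BIIK.det := isUnit_BIIK_det_of_posDef hII
  have hinv : ∀ i i', 0 ≤ (-W.BIIK)⁻¹ i i' := posDef_isZMatrix_inv_nonneg hII hZII
  have hdiag : 0 < (-W.BIIK)⁻¹ i i := hII.inv.diag_pos
  have hv : ∀ j, 0 < -(W.K j * W.Estar j) := fun j =>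
    neg_pos.2 (mul_neg_of_neg_of_pos (hK j) (hEs j))
  have hd : diagonal W.K *ᵥ W.Estar = fun j => W.K j * W.Estar j :=
    funext fun j => mulVec_diagonal _ _ j
  have hrew : (W.BIIK⁻¹ *ᵥ (diagonal W.K *ᵥ W.Estar)) i
      = ∑ j, (-W.BIIK)⁻¹ i j * -(W.K j * W.Estar j) := by
    rw [inv_neg_eq' hUII, hd]
    simp only [mulVec, dotProduct, Matrix.neg_apply]
    exact Finset.sum_congr rfl fun j _ => by ring
  rw [hrew]
  calc (0 : ℝ) < (-W.BIIK)⁻¹ i i * -(W.K i * W.Estar i) := mul_pos hdiag (hv i)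
    _ ≤ ∑ j, (-W.BIIK)⁻¹ i j * -(W.K j * W.Estar j) :=
        Finset.single_le_sum (f := fun j => (-W.BIIK)⁻¹ i j * -(W.K j * W.Estar j))
          (fun j _ => mul_nonneg (hinv i j) (hv j).le) (Finset.mem_univ i)

variable {W} in
/-- **`B_redE_L* ≤ 0` componentwise** (`B_redE_L* = −B_LI(B_II + K_I)⁻¹K_IE_I*` with `B_LI ≥ 0` and
`(B_II + K_I)⁻¹K_IE_I* > 0`). The print asserts the STRICT inequality («since `B_redE_L* < 0_n`
component-wise», §3.3); strictness needs a line from the load bus to some inverter, next lemma.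
[cite: SimpsonporcoDorflerBullo2017, §3.3 after Theorem 3.3 («since `B_redE_L^* < 0_n` component-wise») and §7 Proposition 7.2] -/
theorem redSource_nonpos (hoff : ∀ k k', k ≠ k' → 0 ≤ W.B k k') (hII : (-W.BIIK).PosDef)
    (hK : ∀ i, W.K i < 0) (hEs : ∀ i, 0 < W.Estar i) (l : Fin n) : W.redSource l ≤ 0 := by
  rw [redSource, Pi.neg_apply, neg_nonpos, ← mulVec_mulVec, mulVec, dotProduct]
  refine Finset.sum_nonneg fun i _ => mul_nonneg ?_ (BIIK_inv_mulVec_K_Estar_pos hoff hII hK hEs i).le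
  rw [BLI_apply']
  exact hoff _ _ (by simp)

variable {W} in
/-- **`(B_redE_L*)_l < 0` at every load bus `l` with a line to some inverter** (`B_{li} > 0` for some
`i ∈ I`) — the sufficient condition under which the print's «`B_redE_L* < 0_n`» (hypothesis (ii) of
Theorem 3.3 at `I_shunt = 0`) holds. [cite: SimpsonporcoDorflerBullo2017, §3.3 after Theorem 3.3 («since `B_redE_L^* < 0_n` component-wise») and §7 Proposition 7.2] -/
theorem redSource_neg_of_exists_line (hoff : ∀ k k', k ≠ k' → 0 ≤ W.B k k') (hII : (-W.BIIK).PosDef)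
    (hK : ∀ i, W.K i < 0) (hEs : ∀ i, 0 < W.Estar i) {l : Fin n}
    (hl : ∃ i, 0 < W.B (Sum.inl l) (Sum.inr i)) : W.redSource l < 0 := by
  obtain ⟨i₀, hi₀⟩ := hl
  rw [redSource, Pi.neg_apply, neg_lt_zero, ← mulVec_mulVec, mulVec, dotProduct]
  have hu := fun i => BIIK_inv_mulVec_K_Estar_pos hoff hII hK hEs i
  calc (0 : ℝ) < W.BLI l i₀ * (W.BIIK⁻¹ *ᵥ (diagonal W.K *ᵥ W.Estar)) i₀ := by
        rw [BLI_apply']; exact mul_pos hi₀ (hu i₀)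
    _ ≤ ∑ i, W.BLI l i * (W.BIIK⁻¹ *ᵥ (diagonal W.K *ᵥ W.Estar)) i :=
        Finset.single_le_sum (f := fun i => W.BLI l i * (W.BIIK⁻¹ *ᵥ (diagonal W.K *ᵥ W.Estar)) i)
          (fun i _ => mul_nonneg (by rw [BLI_apply']; exact hoff _ _ (by simp)) (hu i).le)
          (Finset.mem_univ i₀)

variable {W} in
/-- **(4.4)**: `E_L^Z = (B_red + [b_shunt])⁻¹B_redE_L*` — the companion's `ziVoltage b_shunt 0`, with
`B_redE_L*` written through the open-circuit load voltages `E_L* = W₁E_I*` (`B_red` invertible).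
[cite: SimpsonporcoDorflerBullo2017, Proposition 4.1 eq. (4.4)] -/
theorem ziVoltage_zero_eq (hred : IsUnit W.Bred.det) (bsh : Fin n → ℝ) :
    W.ziVoltage bsh 0 = (W.Bred + diagonal bsh)⁻¹ *ᵥ (W.Bred *ᵥ W.ELstar) := by
  rw [ziVoltage, sub_zero, Bred_mulVec_ELstar hred]

variable {W} in
/-- **Proposition 4.1 (Optimality and Quadratic Droop), assembled** (matrix-level data as Proposition
7.2 states them: `B` symmetric with nonnegative off-diagonal entries and zero row sums,
`−(B + blkdiag(0, K_I)) ≻ 0`, `K_i < 0`, `E_i* > 0`; `τ_i > 0`; cost coefficients `κ = K`;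
constant-impedance loads `Q_l(E_l) = b_lE_l²`; Theorem 3.3's (i) `−(B_red + [b_shunt])` an `M`-matrix
(positive definite; its `Z`-pattern is automatic) and (ii) at `I_shunt = 0`: `B_redE_L* < 0`, see
`redSource_neg_of_exists_line`).  With `E^Z = (E_L^Z, E_I^Z) = ziState b_shunt 0`:
(a) `E^Z ∈ ℝ^{n+m}_{>0}`, `E_L^Z = (B_red + [b_shunt])⁻¹B_redE_L*` (4.4), `E_I^Z = W₂(E_L^Z, E_I*)` (3.8);
(b) `E^Z` is an equilibrium of the closed loop (3.3) with Z loads and the ONLY one in `ℝ^{n+m}_{>0}`;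
(c) the Hessian `2𝒜` of `C` is positive definite and `E^Z` is the unique critical point of `C`
(`𝒜E = c ⟺ E = E^Z`); (d) `E^Z` is the STRICT GLOBAL MINIMISER of the cost (4.3): `C(E^Z) < C(E)`
for every `E ≠ E^Z` in `ℝ^{n+m}`; (e) `E^Z` is locally exponentially stable for the DAE (3.3) in the
sense of Theorem 3.2's tier (companion `theorem_3_3_locallyExpStable` at `I_shunt = 0`).
[cite: SimpsonporcoDorflerBullo2017, §4.1 Proposition 4.1 (p0013 L41–L49) with its proof (p0013 L50 – p0014 L10), Theorem 3.3, §7 Proposition 7.2] -/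
theorem proposition_4_1 {bsh : Fin n → ℝ} (hB : W.B.IsSymm)
    (hoff : ∀ k k', k ≠ k' → 0 ≤ W.B k k') (hrowB : ∀ k, ∑ k', W.B k k' = 0)
    (hM : (-(W.B + Matrix.fromBlocks 0 0 0 (diagonal W.K))).PosDef) (hK : ∀ i, W.K i < 0)
    (hEs : ∀ i, 0 < W.Estar i) (hτ : ∀ i, 0 < W.τ i) (hA : (-(W.Bred + diagonal bsh)).PosDef)
    (hI : ∀ l, W.redSource l < 0) :
    (∀ k, 0 < W.ziState bsh 0 k) ∧
      (fun l => W.ziState bsh 0 (Sum.inl l)) = (W.Bred + diagonal bsh)⁻¹ *ᵥ (W.Bred *ᵥ W.ELstar) ∧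
      (fun i => W.ziState bsh 0 (Sum.inr i)) = W.invVoltage (fun l => W.ziState bsh 0 (Sum.inl l)) ∧
      W.IsEquilibrium (ziLoad bsh 0) (W.ziState bsh 0) ∧
      (∀ E : Fin n ⊕ Fin m → ℝ, (∀ k, 0 < E k) →
        (W.IsEquilibrium (ziLoad bsh 0) E ↔ E = W.ziState bsh 0)) ∧
      (W.costMatrix bsh W.K).PosDef ∧
      (∀ E : Fin n ⊕ Fin m → ℝ, W.costMatrix bsh W.K *ᵥ E = W.costSource W.K ↔ E = W.ziState bsh 0) ∧
      (∀ E : Fin n ⊕ Fin m → ℝ, E ≠ W.ziState bsh 0 →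
        W.optCost bsh W.K (W.ziState bsh 0) < W.optCost bsh W.K E) ∧
      (∃ ρ > 0, ∃ k > 0, ∃ lam > 0, ∀ (E : ℝ → Fin n ⊕ Fin m → ℝ) (T : ℝ),
        W.IsDAESolutionOn (ziLoad bsh 0) E T → ‖E 0 - W.ziState bsh 0‖ < ρ →
          ∀ t ∈ Icc (0 : ℝ) T,
            ‖E t - W.ziState bsh 0‖ ≤ k * ‖E 0 - W.ziState bsh 0‖ * Real.exp (-lam * t)) := by
  have hII := posDef_neg_BIIK_of_posDef_aug hM
  have hU : IsUnit W.BIIK.det := isUnit_BIIK_det_of_posDef hII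
  obtain ⟨⟨hred, -⟩, -, -, -⟩ := proposition_7_2 hB hoff hrowB hM (fun i => (hK i).le) hEs
  have hUred : IsUnit W.Bred.det := by
    have h1 : IsUnit (-W.Bred).det := (isUnit_iff_isUnit_det _).1 hred.isUnit
    rw [det_neg, isUnit_iff_ne_zero, mul_ne_zero_iff] at h1
    exact isUnit_iff_ne_zero.2 h1.2
  have hUb : IsUnit (W.Bred + diagonal bsh).det := by
    have h1 : IsUnit (-(W.Bred + diagonal bsh)).det := (isUnit_iff_isUnit_det _).1 hA.isUnit
    rw [det_neg, isUnit_iff_ne_zero, mul_ne_zero_iff] at h1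
    exact isUnit_iff_ne_zero.2 h1.2
  obtain ⟨-, -, hZ⟩ := stieltjes_neg_Bred hB hoff hM bsh
  have hI' : ∀ l, W.redSource l < (0 : Fin n → ℝ) l := fun l => hI l
  obtain ⟨heq, hpos, -, -⟩ := theorem_3_3_originalNetwork hB hoff hrowB hM (fun i => (hK i).le) hEs
    hA hZ hI'
  have hAp : (W.costMatrix bsh W.K).PosDef := (costMatrix_posDef_iff hB hII bsh).2 hA
  have hcrit : W.costMatrix bsh W.K *ᵥ W.ziState bsh 0 = W.costSource W.K :=
    (firstOrder_iff_eq_ziState hU hUb _).2 rfl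
  refine ⟨hpos, ?_, rfl, heq, fun E hE => isEquilibrium_zLoads_iff_eq_ziState hU hUb hE, hAp,
    fun E => firstOrder_iff_eq_ziState hU hUb E, fun E hne => optCost_lt_of_ne hB hAp hcrit hne, ?_⟩
  · exact ziVoltage_zero_eq hUred bsh
  · exact theorem_3_3_locallyExpStable hB hoff hrowB hM (fun i => (hK i).le) hEs hτ hA hZ hI'

variable {W} in
/-- **Proposition 4.1 from network data** (connected inductive network `B = susceptanceMatrix w`,
`w` symmetric `≥ 0`, `BranchConnected w`; `K_i < 0`, `E_i* > 0`, `τ_i > 0`, at least one inverter;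
(i) `−(B_red + [b_shunt]) ≻ 0`; (ii′) every load bus has a line to some inverter bus — which gives
`B_redE_L* < 0` by `redSource_neg_of_exists_line`): the conclusions of `proposition_4_1`.
[cite: SimpsonporcoDorflerBullo2017, §4.1 Proposition 4.1 with §7 Lemma 7.1 and Proposition 7.2] -/
theorem proposition_4_1_of_network {w : Fin n ⊕ Fin m → Fin n ⊕ Fin m → ℝ} {bsh : Fin n → ℝ}
    (hw : ∀ i j, w i j = w j i) (hw0 : ∀ i j, 0 ≤ w i j) (hconn : BranchConnected w)
    (hBw : W.B = susceptanceMatrix w) (hK : ∀ i, W.K i < 0) (hm : 0 < m) (hEs : ∀ i, 0 < W.Estar i)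
    (hτ : ∀ i, 0 < W.τ i) (hA : (-(W.Bred + diagonal bsh)).PosDef)
    (hline : ∀ l : Fin n, ∃ i : Fin m, 0 < w (Sum.inl l) (Sum.inr i)) :
    (∀ k, 0 < W.ziState bsh 0 k) ∧
      (fun l => W.ziState bsh 0 (Sum.inl l)) = (W.Bred + diagonal bsh)⁻¹ *ᵥ (W.Bred *ᵥ W.ELstar) ∧
      (fun i => W.ziState bsh 0 (Sum.inr i)) = W.invVoltage (fun l => W.ziState bsh 0 (Sum.inl l)) ∧
      W.IsEquilibrium (ziLoad bsh 0) (W.ziState bsh 0) ∧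
      (∀ E : Fin n ⊕ Fin m → ℝ, (∀ k, 0 < E k) →
        (W.IsEquilibrium (ziLoad bsh 0) E ↔ E = W.ziState bsh 0)) ∧
      (W.costMatrix bsh W.K).PosDef ∧
      (∀ E : Fin n ⊕ Fin m → ℝ, W.costMatrix bsh W.K *ᵥ E = W.costSource W.K ↔ E = W.ziState bsh 0) ∧
      (∀ E : Fin n ⊕ Fin m → ℝ, E ≠ W.ziState bsh 0 →
        W.optCost bsh W.K (W.ziState bsh 0) < W.optCost bsh W.K E) ∧
      (∃ ρ > 0, ∃ k > 0, ∃ lam > 0, ∀ (E : ℝ → Fin n ⊕ Fin m → ℝ) (T : ℝ),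
        W.IsDAESolutionOn (ziLoad bsh 0) E T → ‖E 0 - W.ziState bsh 0‖ < ρ →
          ∀ t ∈ Icc (0 : ℝ) T,
            ‖E t - W.ziState bsh 0‖ ≤ k * ‖E 0 - W.ziState bsh 0‖ * Real.exp (-lam * t)) := by
  have hB : W.B.IsSymm := by rw [hBw]; exact susceptanceMatrix_isSymm hw
  have hoff : ∀ k k', k ≠ k' → 0 ≤ W.B k k' := fun k k' hkk' => by
    rw [hBw]; exact susceptanceMatrix_offDiag_nonneg hw0 hkk'
  have hrowB : ∀ k, ∑ k', W.B k k' = 0 := fun k => by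
    rw [hBw]; exact sum_susceptanceMatrix_row w k
  have hM := posDef_neg_aug_of_branchConnected hw hw0 hconn hBw hK hm
  have hII := posDef_neg_BIIK_of_posDef_aug hM
  have hI : ∀ l, W.redSource l < 0 := by
    intro l
    obtain ⟨i, hi⟩ := hline l
    refine redSource_neg_of_exists_line hoff hII hK hEs ⟨i, ?_⟩
    rw [hBw, susceptanceMatrix_apply_ne w (by simp)]
    exact hi
  exact proposition_4_1 hB hoff hrowB hM hK hEs hτ hA hI

end QuadDroopNetwork

end Literature.MathematicalPhysics.PowerSystems
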